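import Summits.ResolutionOfSingularities.ResolutionOfSingularities.Theorems.MarkedTransferCampaignW12SandwichBoxCriterion
import Literature.AlgebraicGeometry.Hironaka2017.Proofs.S09LLUED.Lem9p28Inst
import HarnessLib

/-!
# [OURS · L1 G1 · SWρ] The Frobenius-sandwich negative MODULE `℘nega_sw(E,−a)` as a `ρ^e(O)`-span
# (value-type variant of W1.2; bounded typing ask of res-adj-1 2026-08-27T02:15:06Z; writer res-L1-type-o2, OURS typer o2)

LADDER-RESOLUTION rung L (rescue), cell `res-hironaka`, group G1 (`℘nega`). CONTEXT: director-resolution 2026-08-27T02:04:38Z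
ruled «SWρ (dropping `O`-stability of the W1.2 sandwich) is a value-type variant of W1.2 that evades only the squeeze and
meets the same F1 obstruction … not booked as a slot; if V3's decisive cell for module-valued candidates turns out LIVE for
SWρ, res-adj-1 may ask o2 for the ½-day typing of `sandwichPNegaRho`»; res-D-plan-1's F6d/F7b RULING 02:09:04Z made the
F6d-gen cell LIVE for SWρ; res-adj-1's BOUNDED ASK 02:15:06Z (items (d1)–(d3), plumbing (ρ1)–(ρ3)) is carried here, in
ONE sibling file of `MarkedTransferCampaignW12SandwichTSharp.lean` (p461383 → p470322, tree sha16 9f9b934c0bbe3850).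
Statements and plumbing only — nothing is claimed for any candidate; res-adj-1 scores the cells.

WHAT IS TYPED.
§1 (d1) `Campaign.sandwichDDRho p e P m a d` — the `ρ^e(O)`-SPAN (not the `O`-ideal) of the SAME generating values as
   row 008's `S05NegativePart.DD` at base `ρ^e(O)` = the tree's `Campaign.sandwichDD` (p.25 L36, Eq. (36) line 2): the
   values `∂ f`, `∂` a differential operator of `O/ρ^e(O)` of order `≤ d·m + a` (`Resolution.IsDiffOpLE`), `f ∈ ℘posi(E,dm)`
   (generator set copied verbatim from `Resolution.diffIdeal`; only `Ideal.span` ↦ `Submodule.span ↥(iterateFrobenius O p e).range`);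
   (d2) `sandwichPTildeNegRho` / `sandwichPNegaRho` — `⨆_{d, dm ≥ |a|}` exactly as `sandwichPTildeNeg` / `sandwichPNega`.
§2 (ρ1) `span_sandwichPNegaRho` : `Ideal.span ↑(sandwichPNegaRho p e P m a) = sandwichPNega p e P m a` (the `O`-span
   recovers SW, so every `Set`-level SW cell transfers); (ρ2) `sandwichPNegaRho_subset` : `↑(sandwichPNegaRho …) ⊆
   ↑(sandwichPNega …)`; corollary `not_isUnit_of_mem_sandwichPNegaRho` (F7b-unit in the class regime is INHERITED from any
   bound `sandwichPNega ≤ M`, `M ≠ ⊤` — e.g. `Campaign.W12.sandwichNegaNoUnit_of_le_frobeniusPower` /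
   `campaignW12SandwichNegaNoUnit_holds` p468852).
§3 (d3) `Campaign.rhoSetFamilyToBl` / `sandwichNegaBlRho ℓ e P m : BlSub O p ℓ` — the `Bl(Z)`-placement of the family
   `a ↦ ℘nega_swρ(E,−a)` in degrees `−a < 0` as ONE `ρ^ℓ(O)`-submodule (the §13 slot value for
   `Campaign.PnegaInterfaceV3.NormDemandGen` / `PnegaInterfaceV2.TailsNonDegenerate`); `sandwichTSharpRho` / `sandwichTFlatRho`
   = row 015's `TSharp` / `TFlat` on it. HONEST NOTE on scalars: a `ρ^e(O)`-module is placed as the `ρ^ℓ(O)`-span of its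
   carrier; under Rem 11.1's convention `e ≤ ℓ` one has `ρ^ℓ(O) ⊆ ρ^e(O)` (tree `S09LLUED.iterateFrobenius_range_le_of_le`) so the span
   does not enlarge the degree pieces (`coe_rhoSpan_eq_of_le`).
§4 (ρ3) BOX REGIME, `O = R[x_σ]`, `char R = p`: `hasseDeriv_mem_sandwichPNegaRho` — a box Hasse derivative VALUE
   `∂^{(γ)} f` (`γ_i < p^e`, `|γ| ≤ dm + a`, `f ∈ ℘(E,dm)`) lies in the MODULE, not merely in the ideal (the operator is
   `ρ^e`-linear, `Campaign.W12.exists_sandwichOp_hasseDeriv`, p469591); hence the module-level twins of the K1.2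
   certificate shapes: `not_sandwichPNegaRho_subset_idealOfVars` (a box monomial with non-zero coefficient defeats «⊆ 𝔪»)
   and the literal unit VALUE `one_mem_sandwichPNegaRho_of_X_pow_mem` («head monomial `y^k ∈ ℘(E,dm)`, `k < p^e` ⇒
   `1 = ∂_y^{(k)} y^k ∈ ℘nega_swρ(E,−a)`», instance `k = m`, `d = 1`: `one_mem_sandwichPNegaRho_of_X_pow_mem_self`) — so
   F7b-unit ✗ in the box regime holds at the module level too. NOT typed (res-adj-1: decided later / elsewhere): the
   F6d-gen, TailsNonDegenerate and HeadTypeSqueeze cells, F1, an F6c-✗ witness.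

HONEST FRAMING. Nothing here is a statement of H. Hironaka's manuscript *Resolution of singularities in positive
characteristics* (2017-03-23, [Hironaka2017], lit key `paper:url-3343fd9e678b`): Def 5.1 / Eq. (36) (p.25 L33–L38) and
Def 13.2 (105) (p.67 L16–L19) enter only as the SHAPES re-based on `ρ^e(O)`, CANDIDATES [claim: Hironaka2017, status:
under-review]. «SWρ» is OURS (a rescue variant named by res-adj-1 / director-resolution), not a reading of the text. AI typing
is weaker than expert review; nothing here is progress on resolution of singularities in positive characteristic; no claim
beyond the kernel.
-/

noncomputable section

set_option linter.dupNamespace false -- mandated namespace of this single-conjunct summit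

namespace Summit.ResolutionOfSingularities.ResolutionOfSingularities.Theorems.Campaign

open LaurentPolynomial
open Literature.AlgebraicGeometry.Resolution
open Literature.AlgebraicGeometry.Hironaka2017
open Literature.AlgebraicGeometry.Hironaka2017.S11CoordFree (BlSub inDegree)

universe u v

section Ring

variable {O : Type v} [CommRing O] (p : ℕ) [Fact p.Prime] [CharP O p]

/-! ## §1 (d1)(d2) The sandwich pieces as `ρ^e(O)`-modules -/

/-- [OURS · L1 G1 SWρ (d1)] replaces the role of Def 5.1's summand `D(m,a,d) = Diff^{(dm+a)} ℘posi(E,dm)` (Eq. (36) line 2,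
p.25 L36) as a `ρ^e(O)`-MODULE: the `ρ^e(O)`-span of the values `∂ f`, `∂` a differential operator of `O/ρ^e(O)` of order
`≤ dm + a`, `f ∈ ℘posi(E,dm)` — the SAME generator set as `Resolution.diffIdeal` inside the tree's `Campaign.sandwichDD`
(row 008 `S05NegativePart.DD` at base `ρ^e(O)`), with `Ideal.span` replaced by `Submodule.span ↥(iterateFrobenius O p e).range`.
Junk outside `dm ≥ |a|` as in row 008. NOT a statement of the manuscript. VACUITY: a term; `⊥` when `℘posi(E,dm) = ⊥`
(e.g. `d·m ≤ 0`). [folklore] -/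
def sandwichDDRho (e : ℕ) (P : ℕ → Ideal O) (m : ℕ) (a d : ℤ) :
    Submodule (↥(iterateFrobenius O p e).range) O :=
  Submodule.span (↥(iterateFrobenius O p e).range)
    {x | ∃ D : O →ₗ[↥(iterateFrobenius O p e).range] O,
      IsDiffOpLE (↥(iterateFrobenius O p e).range) (d * m + a).toNat D ∧
        ∃ f ∈ S05NegativePart.pPosi P (d * m).toNat, D f = x}

/-- [OURS · L1 G1 SWρ (d2)] replaces the role of Def 5.1's `℘̃(E,−a) = Σ_{dm ≥ |a|} D(m,a,d)` (Eq. (36) line 1, p.25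
L33–L35) as a `ρ^e(O)`-MODULE: `⨆_{d, dm ≥ |a|} sandwichDDRho`, indexation exactly as `Campaign.sandwichPTildeNeg` /
row 008 `pTildeNeg` (`a : ℤ`, degree `−a`). NOT a statement of the manuscript. [folklore] -/
def sandwichPTildeNegRho (e : ℕ) (P : ℕ → Ideal O) (m : ℕ) (a : ℤ) :
    Submodule (↥(iterateFrobenius O p e).range) O :=
  ⨆ (d : ℤ) (_ : |a| ≤ d * m), sandwichDDRho p e P m a d

/-- [OURS · L1 G1 SWρ (d2)] replaces the role of Def 5.1's `℘nega(E,−a)`, `a ≥ 0` (p.25 L37–L38) as a `ρ^e(O)`-MODULE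
— «`℘nega_swρ(E,−a)`», the value-type variant SWρ of W1.2 (director-resolution 2026-08-27T02:04:38Z; res-adj-1
02:15:06Z): `sandwichPTildeNegRho` at `a : ℕ`, exactly as `Campaign.sandwichPNega`. NOT a statement of the manuscript.
[folklore] -/
def sandwichPNegaRho (e : ℕ) (P : ℕ → Ideal O) (m a : ℕ) : Submodule (↥(iterateFrobenius O p e).range) O :=
  sandwichPTildeNegRho p e P m (a : ℤ)

/-- Unfolding (by `rfl`). [folklore] -/
theorem sandwichPNegaRho_eq (e : ℕ) (P : ℕ → Ideal O) (m a : ℕ) :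
    sandwichPNegaRho p e P m a = ⨆ (d : ℤ) (_ : |(a : ℤ)| ≤ d * m), sandwichDDRho p e P m a d :=
  rfl

/-! ## §2 (ρ1)(ρ2) Plumbing: the `O`-span recovers SW, the module sits inside SW -/

/-- (ρ1 at one summand) The `O`-ideal generated by the module `sandwichDDRho` is the tree's ideal `sandwichDD` (same
generators). [folklore] -/
theorem span_sandwichDDRho (e : ℕ) (P : ℕ → Ideal O) (m : ℕ) (a d : ℤ) :
    Ideal.span (sandwichDDRho p e P m a d : Set O) = sandwichDD p e P m a d := by
  unfold sandwichDDRho sandwichDD S05NegativePart.DD diffIdeal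
  apply le_antisymm
  · rw [Ideal.span_le]
    change Submodule.span (↥(iterateFrobenius O p e).range) _ ≤
      (Ideal.span _).restrictScalars (↥(iterateFrobenius O p e).range)
    exact Submodule.span_le.mpr Ideal.subset_span
  · exact Ideal.span_mono Submodule.subset_span

/-- (ρ2 at one summand) `sandwichDDRho ⊆ sandwichDD` as sets. [folklore] -/
theorem sandwichDDRho_subset (e : ℕ) (P : ℕ → Ideal O) (m : ℕ) (a d : ℤ) :
    (sandwichDDRho p e P m a d : Set O) ⊆ (sandwichDD p e P m a d : Set O) := by
  rw [← span_sandwichDDRho]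
  exact Ideal.subset_span

/-- **(ρ1)** The `O`-span of the SWρ module IS the W1.2 sandwich ideal: `Ideal.span ↑℘nega_swρ(E,−a) = ℘nega_sw(E,−a)` —
so every `Set`-level cell already scored on SW (containments `℘nega_sw ⊆ M`) transfers to SWρ. [folklore] -/
theorem span_sandwichPNegaRho (e : ℕ) (P : ℕ → Ideal O) (m a : ℕ) :
    Ideal.span (sandwichPNegaRho p e P m a : Set O) = sandwichPNega p e P m a := by
  unfold sandwichPNegaRho sandwichPTildeNegRho sandwichPNega S05NegativePart.pNega S05NegativePart.pTildeNeg
  apply le_antisymm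
  · rw [Ideal.span_le]
    change (⨆ (d : ℤ) (_ : |(a : ℤ)| ≤ d * m), sandwichDDRho p e P m a d) ≤
      (⨆ (d : ℤ) (_ : |(a : ℤ)| ≤ d * m), S05NegativePart.DD (↥(iterateFrobenius O p e).range) P m a d).restrictScalars
        (↥(iterateFrobenius O p e).range)
    refine iSup₂_le fun d hd => ?_
    intro x hx
    have hx' : x ∈ sandwichDD p e P m a d := sandwichDDRho_subset p e P m a d hx
    exact (le_iSup₂ (f := fun (d : ℤ) (_ : |(a : ℤ)| ≤ d * m) =>
      S05NegativePart.DD (↥(iterateFrobenius O p e).range) P m a d) d hd) hx'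
  · refine iSup₂_le fun d hd => ?_
    change sandwichDD p e P m a d ≤ _
    rw [← span_sandwichDDRho]
    refine Ideal.span_mono ?_
    exact (le_iSup₂ (f := fun (d : ℤ) (_ : |(a : ℤ)| ≤ d * m) => sandwichDDRho p e P m a d) d hd :)

/-- **(ρ2)** `℘nega_swρ(E,−a) ⊆ ℘nega_sw(E,−a)` as sets. [folklore] -/
theorem sandwichPNegaRho_subset (e : ℕ) (P : ℕ → Ideal O) (m a : ℕ) :
    (sandwichPNegaRho p e P m a : Set O) ⊆ (sandwichPNega p e P m a : Set O) := by
  rw [← span_sandwichPNegaRho]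
  exact Ideal.subset_span

/-- **F7b-unit is inherited from SW.** If the W1.2 ideal `℘nega_sw(E,−a)` lies in a proper ideal `M` (the class regime:
`Campaign.W12.sandwichPNega_le_of_le_frobeniusPower`, `campaignW12SandwichNegaNoUnit_holds` p468852), then the SWρ module
`℘nega_swρ(E,−a)` contains NO UNIT (the F7b-unit demand of `Campaign.PnegaInterfaceV3.neg_proper`, res-D-plan-1
02:09:04Z). [folklore] -/
theorem not_isUnit_of_mem_sandwichPNegaRho (e : ℕ) (P : ℕ → Ideal O) (m a : ℕ) {M : Ideal O} (hM : M ≠ ⊤)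
    (hle : sandwichPNega p e P m a ≤ M) {u : O} (hu : u ∈ sandwichPNegaRho p e P m a) : ¬ IsUnit u :=
  fun hunit => hM (Ideal.eq_top_of_isUnit_mem M (hle (sandwichPNegaRho_subset p e P m a hu)) hunit)

/-! ## §3 (d3) Placement in `Bl(Z)` for the §13 slot -/

variable {p}

/-- Plumbing (OURS, no printed counterpart): a `ℤ`-indexed family of SUBSETS `N i ⊆ O = Bl(Z,i)` placed degree-wise into
`Bl(Z) = O[T;T⁻¹]` as ONE `ρ^ℓ(O)`-submodule, `⨆_i inDegree i (span_{ρ^ℓ(O)} (N i))` — the set-level analogue of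
`Campaign.idealFamilyToBl` (which restricts the scalars of `O`-ideals). For a family of `ρ^e(O)`-modules with `e ≤ ℓ`
(Rem 11.1's convention `ℓ ≫ e`) the `ρ^ℓ(O)`-span does not enlarge the pieces (`coe_rhoSpan_eq_of_le`). [folklore] -/
def rhoSetFamilyToBl {ℓ : ℕ} (N : ℤ → Set O) : BlSub O p ℓ :=
  ⨆ i : ℤ, inDegree i (Submodule.span (↥(iterateFrobenius O p ℓ).range) (N i))

/-- For `e ≤ ℓ` the `ρ^ℓ(O)`-span of a `ρ^e(O)`-submodule's carrier is that carrier (no enlargement; uses the tree's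
`S09LLUED.iterateFrobenius_range_le_of_le` «`ρ^ℓ(O) ⊆ ρ^e(O)`», `Proofs/S09LLUED/Lem9p28Inst.lean`). [folklore] -/
theorem coe_rhoSpan_eq_of_le {e ℓ : ℕ} (h : e ≤ ℓ) (M : Submodule (↥(iterateFrobenius O p e).range) O) :
    (Submodule.span (↥(iterateFrobenius O p ℓ).range) (M : Set O) : Set O) = (M : Set O) := by
  apply Set.Subset.antisymm
  · intro x hx
    refine Submodule.span_induction (p := fun y _ => y ∈ (M : Set O)) (fun y hy => hy) M.zero_mem
      (fun y z _ _ hy hz => M.add_mem hy hz) ?_ hx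
    rintro ⟨r, hr⟩ y _ hy
    have hr' : r ∈ (iterateFrobenius O p e).range := S09LLUED.iterateFrobenius_range_le_of_le p h hr
    exact M.smul_mem ⟨r, hr'⟩ hy
  · exact Submodule.subset_span

variable (p)

/-- [OURS · L1 G1 SWρ (d3)] replaces the role of `℘nega(Ě) = ⨁_{a>0} ℘nega(Ě,−a) ⊂ Bl(Z)` (Def 5.1 p.25 L38) as the
second summand of Def 13.2 (105) (p.67 L17), for the SWρ modules: `sandwichPNegaRho p e P m a`, `a > 0`, placed in degrees
`−a` of `Bl(Z)` as one `ρ^ℓ(O)`-submodule (degrees `≥ 0` get `∅`). This is the §13 SLOT VALUE `pnega : BlSub O p ℓ` of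
`Campaign.PnegaInterfaceV3.NormDemandGen ℓ e L0inf pposi pnega` (F6d-gen, the decisive cell for module-valued candidates,
res-D-plan-1 02:09:04Z) and of `Campaign.PnegaInterfaceV2.TailsNonDegenerate`. NOT a statement of the manuscript.
[folklore] -/
def sandwichNegaBlRho (ℓ e : ℕ) (P : ℕ → Ideal O) (m : ℕ) : BlSub O p ℓ :=
  rhoSetFamilyToBl fun i : ℤ => if i < 0 then (sandwichPNegaRho p e P m i.natAbs : Set O) else ∅

/-- [OURS · L1 G1 SWρ] replaces the role of Def 13.2 Eq. (105) `𝔗♯(Ě) = (𝔏_0(∞) ∩ ℘posi) + ℘nega` (p.67 L16–L18) for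
SWρ: row 015's `S13GLUEDDiagram.TSharp` at `pnega := sandwichNegaBlRho`. NOT a statement of the manuscript. [folklore] -/
def sandwichTSharpRho (ℓ e : ℕ) (L0inf pposi : BlSub O p ℓ) (P : ℕ → Ideal O) (m : ℕ) : BlSub O p ℓ :=
  S13GLUEDDiagram.TSharp L0inf pposi (sandwichNegaBlRho p ℓ e P m)

/-- [OURS · L1 G1 SWρ] replaces the role of Def 13.2 `𝔗♭(Ě) = ∥𝔗♯(Ě)∥` (p.67 L19) for SWρ: row 015's
`S13GLUEDDiagram.TFlat` at `pnega := sandwichNegaBlRho`. NOT a statement of the manuscript. [folklore] -/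
def sandwichTFlatRho (ℓ e : ℕ) (L0inf pposi : BlSub O p ℓ) (P : ℕ → Ideal O) (m : ℕ) :
    Submodule (↥(iterateFrobenius O p ℓ).range) O :=
  S13GLUEDDiagram.TFlat L0inf pposi (sandwichNegaBlRho p ℓ e P m)

/-- Unfolding anchor: `sandwichTSharpRho` IS row 015's `TSharp` on the SWρ placement (by `rfl`). [folklore] -/
theorem sandwichTSharpRho_eq (ℓ e : ℕ) (L0inf pposi : BlSub O p ℓ) (P : ℕ → Ideal O) (m : ℕ) :
    sandwichTSharpRho p ℓ e L0inf pposi P m = S13GLUEDDiagram.TSharp L0inf pposi (sandwichNegaBlRho p ℓ e P m) :=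
  rfl

end Ring

/-! ## §4 (ρ3) Box regime over `R[x_σ]`: Hasse-derivative VALUES lie in the module -/

section Box

open MvPolynomial

variable {σ : Type u} {R : Type v} [CommRing R] (p : ℕ) [Fact p.Prime] [CharP R p]

/-- **(ρ3, value membership)** For a box multi-index `γ` (`γ_i < p^e`), `|γ| ≤ dm + a`, `a ≤ dm`, `dm ≠ 0` and
`f ∈ ℘(E,dm)`: the VALUE `∂^{(γ)} f` lies in the SWρ MODULE `℘nega_swρ(E,−a)` (not merely in the ideal `℘nega_sw`),
because `∂^{(γ)}` is a `ρ^e`-linear operator of order `≤ |γ|` relative to `ρ^e` (`Campaign.W12.exists_sandwichOp_hasseDeriv`)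
— a generator value of `sandwichDDRho` at the summand `d`. [folklore] -/
theorem hasseDeriv_mem_sandwichPNegaRho [DecidableEq σ] (e : ℕ) (P : ℕ → Ideal (MvPolynomial σ R)) (m a d : ℕ)
    (had : a ≤ d * m) (hdm : d * m ≠ 0) {γ : σ →₀ ℕ} (hγ : ∀ i, γ i < p ^ e) (hdeg : γ.degree ≤ d * m + a)
    {f : MvPolynomial σ R} (hf : f ∈ P (d * m)) :
    hasseDeriv R γ f ∈ sandwichPNegaRho p e P m a := by
  obtain ⟨D, hD, hDf⟩ := W12.exists_sandwichOp_hasseDeriv (R := R) p e hγ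
  rw [← hDf]
  unfold sandwichPNegaRho sandwichPTildeNegRho
  have hdm' : |(a : ℤ)| ≤ (d : ℤ) * m := by
    rw [Nat.abs_cast]; exact_mod_cast had
  refine (le_iSup₂ (f := fun (d : ℤ) (_ : |(a : ℤ)| ≤ d * m) =>
    sandwichDDRho p e P m a d) (d : ℤ) hdm') ?_
  unfold sandwichDDRho
  refine Submodule.subset_span ⟨D, ?_, f, ?_, rfl⟩
  · have h2 : ((d : ℤ) * m + a).toNat = d * m + a := by
      rw [show ((d : ℤ) * m + a) = ((d * m + a : ℕ) : ℤ) by push_cast; ring, Int.toNat_natCast]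
    rw [h2]
    exact hD.of_le hdeg
  · have h1 : ((d : ℤ) * m).toNat = d * m := by
      rw [show ((d : ℤ) * m) = ((d * m : ℕ) : ℤ) by push_cast; ring, Int.toNat_natCast]
    rw [h1]
    simpa [S05NegativePart.pPosi, hdm] using hf

/-- **(ρ3, module-level K1.2 certificate shape)** A box monomial `x^γ` of `f ∈ ℘(E,dm)` with non-zero coefficient
(`|γ| ≤ dm + a`) defeats «`℘nega_swρ(E,−a) ⊆ 𝔪 = (x_i)_i`» already for the MODULE: it contains `∂^{(γ)} f`, whose constant
term is `coeff_γ f` — the twin of `Campaign.W12.not_sandwichPNega_le_idealOfVars`. [folklore] -/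
theorem not_sandwichPNegaRho_subset_idealOfVars [DecidableEq σ] (e : ℕ) (P : ℕ → Ideal (MvPolynomial σ R))
    (m a d : ℕ) (had : a ≤ d * m) (hdm : d * m ≠ 0) {γ : σ →₀ ℕ} (hγ : ∀ i, γ i < p ^ e)
    (hdeg : γ.degree ≤ d * m + a) {f : MvPolynomial σ R} (hf : f ∈ P (d * m)) (hc : coeff γ f ≠ 0) :
    ¬ (sandwichPNegaRho p e P m a : Set (MvPolynomial σ R)) ⊆ (idealOfVars σ R : Set (MvPolynomial σ R)) := by
  intro h
  have hmem : hasseDeriv R γ f ∈ idealOfVars σ R :=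
    h (hasseDeriv_mem_sandwichPNegaRho p e P m a d had hdm hγ hdeg hf)
  apply hc
  rw [← constantCoeff_hasseDeriv R γ f]
  exact coeff_zero_eq_zero_of_mem_idealOfVars R hmem

/-- **(ρ3, the unit as a VALUE)** «Head monomial» regime: if a pure power `x_i^k` with `k < p^e` lies in `℘(E,dm)`
(`dm ≠ 0`, `k ≤ dm + a`, `a ≤ dm`), then `1 = ∂_{x_i}^{(k)} x_i^k` is an ELEMENT of the SWρ module `℘nega_swρ(E,−a)` — so
F7b-unit ✗ in the box regime holds at the module level, not only for the `O`-ideal. NOT claimed for any particular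
witness of the register (their certificates are res-L1-k12's). [folklore] -/
theorem one_mem_sandwichPNegaRho_of_X_pow_mem [DecidableEq σ] (e : ℕ) (P : ℕ → Ideal (MvPolynomial σ R))
    (m a d : ℕ) (had : a ≤ d * m) (hdm : d * m ≠ 0) (i : σ) {k : ℕ} (hk : k < p ^ e) (hkdeg : k ≤ d * m + a)
    (hX : (X i : MvPolynomial σ R) ^ k ∈ P (d * m)) :
    (1 : MvPolynomial σ R) ∈ sandwichPNegaRho p e P m a := by
  have hγ : ∀ j, (Finsupp.single i k) j < p ^ e := by
    intro j
    by_cases hj : j = i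
    · subst hj; simpa using hk
    · rw [Finsupp.single_eq_of_ne hj]
      exact pow_pos (Fact.out : p.Prime).pos e
  have hdeg : (Finsupp.single i k).degree ≤ d * m + a := by
    rw [Finsupp.degree_single]; exact hkdeg
  have h := hasseDeriv_mem_sandwichPNegaRho p e P m a d had hdm hγ hdeg hX
  rwa [hasseDeriv_X_pow, Nat.choose_self, Nat.sub_self, pow_zero, Nat.cast_one, mul_one] at h

/-- **(ρ3, instance `k = m`, `d = 1`)** res-adj-1's box-regime sentence verbatim: «head monomial `y^m ∈ ℘(E,m)`, `m < p^e`
⇒ `(1 : O) ∈ ℘nega_swρ(E,−a)` via `∂_y^{(m)} y^m = 1`», for every `a ≤ m`. [folklore] -/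
theorem one_mem_sandwichPNegaRho_of_X_pow_mem_self [DecidableEq σ] (e : ℕ) (P : ℕ → Ideal (MvPolynomial σ R))
    {m : ℕ} (hm0 : m ≠ 0) (hm : m < p ^ e) (i : σ) (hX : (X i : MvPolynomial σ R) ^ m ∈ P m) (a : ℕ) (ha : a ≤ m) :
    (1 : MvPolynomial σ R) ∈ sandwichPNegaRho p e P m a :=
  one_mem_sandwichPNegaRho_of_X_pow_mem p e P m a 1 (by simpa using ha) (by simpa using hm0) i hm
    (by omega) (by simpa using hX)

end Box

end Summit.ResolutionOfSingularities.ResolutionOfSingularities.Theorems.Campaign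

end
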